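import Literature.NumberTheory.Transcendental.BakerLogarithms
import HarnessLib

/-!
# Baker's theorem — proof of Lemma 7 (the augmentative polynomial)

Trunk T-TRANSCEND, family `periods`, fact `Literature.NumberTheory.Transcendental.baker`; this file discharges the named fact
`Literature.NumberTheory.Transcendental.Baker1975.Lemma7` of `BakerLogarithms.lean`:

**Baker 1975, Ch. 2, Lemma 7** (p. 25). For distinct `σ₀, …, σ_{R-1} ∈ ℂ` with `|σᵢ| ≤ σ`
(`σ ≥ 1`) and `|σᵢ - σⱼ| ≥ ρ` (`0 < ρ ≤ 1`), and any `r < R`, `s < S`, there is a polynomial `W` of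
degree `< RS` with coefficients of absolute value at most `(8σ/ρ)^{RS}` such that
`W^{(j)}(σᵢ) = δ_{(i,j),(r,s)}` for all `i < R`, `j < S`.

## Proof

We follow the source's second expression for `W` (p. 25, bottom), made algebraic. Put
`Y = z - σ_r`, `dᵢ = σ_r - σᵢ` (`i ≠ r`), `t = S - 1 - s`, `U_r(z) = ∏_{i ≠ r} (z - σᵢ)^S`. In
`ℂ⟦Y⟧` the series `∏_{i ≠ r} (Y + dᵢ)^{-S}` has coefficients
`q_k = ∑_{∑ kᵢ = k} ∏ binom(S+kᵢ-1, kᵢ) (-1)^{kᵢ} dᵢ^{-S-kᵢ}` (Baker's `v(j₀,…,j_{R-1})` up to sign,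
with `j_r = t - k`), and
`W(z) = (1/s!) ∑_{k ≤ t} q_k (z - σ_r)^{s+k} U_r(z)`.
Then `U_r ∣ W` gives the vanishing at `σᵢ`, `i ≠ r`, to order `S`; and since
`(∑_{k ≤ t} q_k Yᵏ) · ∏_{i≠r} (Y + dᵢ)^S ≡ 1 (mod Y^{t+1})`, we get
`W ≡ (z - σ_r)^s / s! (mod (z - σ_r)^S)`, whence `W^{(j)}(σ_r) = δ_{js}` for `j < S`. The bound:
`|q_k| ≤ (t+1)^{R-2} (2/ρ)^{(R-1)S + k}` (each factor has coefficients `≤ binom(S+n-1,n) ρ^{-S-n}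
≤ (2/ρ)^S (2/ρ)ⁿ`), the monic products have coefficients `≤ (1+σ)^{RS-1}`, and
`(t+1)^R (2/ρ)^{RS} (2σ)^{RS} ≤ (8σ/ρ)^{RS}` as on p. 26 of the source.

The inverse binomial series comes from Mathlib's `PowerSeries.invOneSubPow` via `rescale`.

## References

* [Baker1975] A. Baker, *Transcendental Number Theory*, Cambridge Univ. Press, 1975, Ch. 2,
  Lemma 7, pp. 25–26.
-/

noncomputable section

open Complex Polynomial Finset

namespace Literature.NumberTheory.Transcendental.Baker1975

/-! ### Auxiliary material (namespace `L7`) -/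

namespace L7

/-- The power series `(X + d)^{-(S'+1)} = d^{-(S'+1)} ∑ₙ binom(S'+n, S') (-X/d)ⁿ`. [folklore] -/
def invPow (d : ℂ) (S' : ℕ) : PowerSeries ℂ :=
  PowerSeries.C ((d ^ (S' + 1))⁻¹) *
    PowerSeries.rescale (-d⁻¹) (PowerSeries.invOneSubPow ℂ (S' + 1)).val

/-- Coefficients of `invPow`: `d^{-(S'+1)} (-1/d)ⁿ binom(S'+n, S')`. [folklore] -/
theorem coeff_invPow (d : ℂ) (S' n : ℕ) :
    PowerSeries.coeff n (invPow d S') =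
      (d ^ (S' + 1))⁻¹ * ((-d⁻¹) ^ n * ((S' + n).choose S' : ℕ)) := by
  simp [invPow, PowerSeries.coeff_C_mul, PowerSeries.coeff_rescale,
    PowerSeries.invOneSubPow_val_succ_eq_mk_add_choose, PowerSeries.coeff_mk]

/-- `(X + d)^{S'+1} · invPow d S' = 1` for `d ≠ 0` (binomial series). [folklore] -/
theorem linPow_mul_invPow (d : ℂ) (hd : d ≠ 0) (S' : ℕ) :
    (PowerSeries.X + PowerSeries.C d) ^ (S' + 1) * invPow d S' = 1 := by
  have h1 : ((1 : PowerSeries ℂ) - PowerSeries.X) ^ (S' + 1) *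
      (PowerSeries.invOneSubPow ℂ (S' + 1)).val = 1 := by
    rw [← PowerSeries.invOneSubPow_inv_eq_one_sub_pow]
    exact (PowerSeries.invOneSubPow ℂ (S' + 1)).inv_val
  have h2 := congrArg (PowerSeries.rescale (-d⁻¹)) h1
  rw [map_mul, map_pow, map_sub, map_one, PowerSeries.rescale_X] at h2
  have hX : PowerSeries.X + PowerSeries.C d =
      PowerSeries.C d * (1 - PowerSeries.C (-d⁻¹) * PowerSeries.X) := by
    have h : PowerSeries.C d * PowerSeries.C (-d⁻¹) = (-1 : PowerSeries ℂ) := by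
      rw [← map_mul, mul_neg, mul_inv_cancel₀ hd, map_neg, map_one]
    linear_combination PowerSeries.X * h
  rw [hX, mul_pow, invPow, ← map_pow]
  calc PowerSeries.C (d ^ (S' + 1)) * (1 - PowerSeries.C (-d⁻¹) * PowerSeries.X) ^ (S' + 1) *
        (PowerSeries.C ((d ^ (S' + 1))⁻¹) *
          PowerSeries.rescale (-d⁻¹) (PowerSeries.invOneSubPow ℂ (S' + 1)).val)
      = PowerSeries.C (d ^ (S' + 1)) * PowerSeries.C ((d ^ (S' + 1))⁻¹) *
          ((1 - PowerSeries.C (-d⁻¹) * PowerSeries.X) ^ (S' + 1) *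
            PowerSeries.rescale (-d⁻¹) (PowerSeries.invOneSubPow ℂ (S' + 1)).val) := by ring
    _ = 1 := by rw [h2, ← map_mul, mul_inv_cancel₀ (pow_ne_zero _ hd), map_one, one_mul]

/-- `|coeff_n invPow| ≤ (2/ρ)^{S'+1} (2/ρ)ⁿ` when `|d| ≥ ρ > 0`, using `binom(m, k) ≤ 2ᵐ`
(Baker 1975, p. 26: "the typical factor … has absolute value at most `2^{S+j-1} ρ^{-S-j}`"). [cite: Baker1975, Ch. 2 Lemma 7] -/
theorem norm_coeff_invPow_le (d : ℂ) (S' n : ℕ) {ρ : ℝ} (hρ : 0 < ρ) (hd : ρ ≤ ‖d‖) :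
    ‖PowerSeries.coeff n (invPow d S')‖ ≤ (2 / ρ) ^ (S' + 1) * (2 / ρ) ^ n := by
  rw [coeff_invPow, norm_mul, norm_mul, norm_inv, norm_pow, norm_pow, norm_neg, norm_inv,
    Complex.norm_natCast]
  have hd0 : 0 < ‖d‖ := lt_of_lt_of_le hρ hd
  have h1 : (‖d‖ ^ (S' + 1))⁻¹ ≤ (ρ ^ (S' + 1))⁻¹ :=
    inv_anti₀ (pow_pos hρ _) (pow_le_pow_left₀ hρ.le hd _)
  have h2 : ‖d‖⁻¹ ^ n ≤ ρ⁻¹ ^ n := pow_le_pow_left₀ (inv_nonneg.mpr hd0.le) (inv_anti₀ hρ hd) _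
  have h3 : (((S' + n).choose S' : ℕ) : ℝ) ≤ 2 ^ (S' + 1) * 2 ^ n := by
    calc (((S' + n).choose S' : ℕ) : ℝ) ≤ 2 ^ (S' + n) := by
          exact_mod_cast Nat.choose_le_two_pow _ _
      _ ≤ 2 ^ (S' + 1 + n) := pow_le_pow_right₀ (by norm_num) (by omega)
      _ = 2 ^ (S' + 1) * 2 ^ n := by rw [pow_add]
  calc (‖d‖ ^ (S' + 1))⁻¹ * (‖d‖⁻¹ ^ n * (((S' + n).choose S' : ℕ) : ℝ))
      ≤ (ρ ^ (S' + 1))⁻¹ * (ρ⁻¹ ^ n * (2 ^ (S' + 1) * 2 ^ n)) := by gcongr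
    _ = (2 / ρ) ^ (S' + 1) * (2 / ρ) ^ n := by rw [div_pow, div_pow, inv_pow]; ring

/-- Truncated geometric coefficient bound: `‖coeff k φ‖ ≤ A αᵏ` for `k ≤ t`. [folklore] -/
def TGB (t : ℕ) (φ : PowerSeries ℂ) (A α : ℝ) : Prop :=
  ∀ k ≤ t, ‖PowerSeries.coeff k φ‖ ≤ A * α ^ k

/-- The constant series `1` has the bound `1 · αᵏ`. [folklore] -/
theorem TGB.one {t : ℕ} {α : ℝ} (hα : 0 ≤ α) : TGB t 1 1 α := by
  intro k _
  rw [PowerSeries.coeff_one]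
  split_ifs with h
  · subst h; simp
  · simpa using by positivity

/-- Products: at most `t + 1` terms in each Cauchy coefficient of index `≤ t`. [folklore] -/
theorem TGB.mul {t : ℕ} {φ ψ : PowerSeries ℂ} {A B α : ℝ} (hB : 0 ≤ B) (hα : 0 ≤ α)
    (h1 : TGB t φ A α) (h2 : TGB t ψ B α) : TGB t (φ * ψ) ((t + 1) * A * B) α := by
  intro k hk
  have hA : 0 ≤ A := by
    have := h1 0 (Nat.zero_le _); simp at this; exact le_trans (norm_nonneg _) this
  rw [PowerSeries.coeff_mul]
  calc ‖∑ p ∈ antidiagonal k, PowerSeries.coeff p.1 φ * PowerSeries.coeff p.2 ψ‖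
      ≤ ∑ p ∈ antidiagonal k, ‖PowerSeries.coeff p.1 φ * PowerSeries.coeff p.2 ψ‖ :=
        norm_sum_le _ _
    _ ≤ ∑ p ∈ antidiagonal k, A * B * α ^ k := by
        refine Finset.sum_le_sum fun p hp => ?_
        rw [Finset.HasAntidiagonal.mem_antidiagonal] at hp
        rw [norm_mul]
        calc ‖PowerSeries.coeff p.1 φ‖ * ‖PowerSeries.coeff p.2 ψ‖
            ≤ (A * α ^ p.1) * (B * α ^ p.2) :=
              mul_le_mul (h1 p.1 (by omega)) (h2 p.2 (by omega)) (norm_nonneg _)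
                (by positivity)
          _ = A * B * α ^ k := by rw [← hp, pow_add]; ring
    _ = (k + 1) * (A * B * α ^ k) := by
        simp [Finset.sum_const, Finset.Nat.card_antidiagonal]
    _ ≤ (t + 1) * (A * B * α ^ k) := by
        have hk' : (k : ℝ) + 1 ≤ t + 1 := by exact_mod_cast Nat.succ_le_succ hk
        exact mul_le_mul_of_nonneg_right hk' (by positivity)
    _ = (t + 1) * A * B * α ^ k := by ring

/-- Finite products of series with a common geometric bound. [folklore] -/
theorem TGB.prod {ι : Type*} [DecidableEq ι] (s : Finset ι) (f : ι → PowerSeries ℂ) {t : ℕ}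
    {A α : ℝ} (hA : 0 ≤ A) (hα : 0 ≤ α) (h : ∀ i ∈ s, TGB t (f i) A α) :
    TGB t (∏ i ∈ s, f i) (((t + 1) * A) ^ s.card) α := by
  induction s using Finset.induction_on with
  | empty => simpa using TGB.one hα
  | insert i s hi ih =>
      rw [prod_insert hi, card_insert_of_notMem hi, pow_succ]
      have h' := (h i (mem_insert_self i s)).mul (by positivity) hα
        (ih fun j hj => h j (mem_insert_of_mem hj))
      intro k hk
      calc ‖PowerSeries.coeff k (f i * ∏ j ∈ s, f j)‖
          ≤ (t + 1) * A * ((t + 1) * A) ^ s.card * α ^ k := h' k hk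
        _ = ((t + 1) * A) ^ s.card * ((t + 1) * A) * α ^ k := by ring

/-- Coefficient bound for a product with a linear factor. [folklore] -/
theorem norm_coeff_mul_X_sub_C_le {p : ℂ[X]} {B : ℝ} (hB : ∀ j, ‖p.coeff j‖ ≤ B) (c : ℂ)
    (j : ℕ) : ‖(p * (X - C c)).coeff j‖ ≤ B * (1 + ‖c‖) := by
  have hB0 : 0 ≤ B := le_trans (norm_nonneg _) (hB 0)
  rw [mul_sub, coeff_sub, coeff_mul_C]
  cases j with
  | zero =>
      rw [coeff_mul_X_zero, zero_sub, norm_neg, norm_mul]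
      calc ‖p.coeff 0‖ * ‖c‖ ≤ B * ‖c‖ := by gcongr; exact hB 0
        _ ≤ B * (1 + ‖c‖) := by gcongr; linarith
  | succ j =>
      rw [coeff_mul_X]
      calc ‖p.coeff j - p.coeff (j + 1) * c‖ ≤ ‖p.coeff j‖ + ‖p.coeff (j + 1) * c‖ :=
            norm_sub_le _ _
        _ ≤ B + B * ‖c‖ := by rw [norm_mul]; gcongr <;> apply hB
        _ = B * (1 + ‖c‖) := by ring

/-- Coefficient bound for a product with a power of a linear factor. [folklore] -/
theorem norm_coeff_mul_X_sub_C_pow_le {p : ℂ[X]} {B M : ℝ} (hB : ∀ j, ‖p.coeff j‖ ≤ B)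
    (hM : 0 ≤ M) {c : ℂ} (hc : ‖c‖ ≤ M) (n j : ℕ) :
    ‖(p * (X - C c) ^ n).coeff j‖ ≤ B * (1 + M) ^ n := by
  have hB0 : 0 ≤ B := le_trans (norm_nonneg _) (hB 0)
  induction n generalizing j with
  | zero => simpa using hB j
  | succ n ih =>
      rw [pow_succ, ← mul_assoc]
      calc ‖(p * (X - C c) ^ n * (X - C c)).coeff j‖ ≤ B * (1 + M) ^ n * (1 + ‖c‖) :=
            norm_coeff_mul_X_sub_C_le ih c j
        _ ≤ B * (1 + M) ^ n * (1 + M) := by gcongr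
        _ = B * (1 + M) ^ (n + 1) := by ring

/-- Coefficient bound for a product with `∏ (X - cᵢ)^{mᵢ}`, `|cᵢ| ≤ M`: the factor is
`(1 + M)^{∑ mᵢ}` (Baker 1975, p. 26: coefficients "at most `(σ+1)^{RS}`"). [cite: Baker1975, Ch. 2 Lemma 7] -/
theorem norm_coeff_mul_prod_pow_le {ι : Type*} [DecidableEq ι] (s : Finset ι) {p : ℂ[X]}
    {B M : ℝ} (hB : ∀ j, ‖p.coeff j‖ ≤ B) (hM : 0 ≤ M) (c : ι → ℂ) (hc : ∀ i ∈ s, ‖c i‖ ≤ M)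
    (m : ι → ℕ) (j : ℕ) :
    ‖(p * ∏ i ∈ s, (X - C (c i)) ^ m i).coeff j‖ ≤ B * (1 + M) ^ ∑ i ∈ s, m i := by
  induction s using Finset.induction_on generalizing j with
  | empty => simpa using hB j
  | insert i s hi ih =>
      have key : p * ∏ k ∈ insert i s, (X - C (c k)) ^ m k =
          (p * ∏ k ∈ s, (X - C (c k)) ^ m k) * (X - C (c i)) ^ m i := by
        rw [prod_insert hi]; ring
      rw [key, sum_insert hi, pow_add]
      have ih' := ih (fun k hk => hc k (mem_insert_of_mem hk))
      calc ‖((p * ∏ k ∈ s, (X - C (c k)) ^ m k) * (X - C (c i)) ^ m i).coeff j‖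
          ≤ B * (1 + M) ^ (∑ k ∈ s, m k) * (1 + M) ^ m i :=
            norm_coeff_mul_X_sub_C_pow_le ih' hM (hc i (mem_insert_self i s)) (m i) j
        _ = B * ((1 + M) ^ m i * (1 + M) ^ ∑ k ∈ s, m k) := by ring


/-! #### The construction -/

section Construction

variable {R : ℕ} (σ : Fin R → ℂ) (r : Fin R)

/-- `∏_{i ≠ r} (X + (σ_r - σ_i))^{-(S'+1)}` as a power series (variable `Y = z - σ_r`); its
coefficients are Baker's `v(j₀, …, j_{R-1})` summed over `j_r` (p. 25). [cite: Baker1975, Ch. 2 Lemma 7] -/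
def Einv (S' : ℕ) : PowerSeries ℂ := ∏ i ∈ univ.erase r, invPow (σ r - σ i) S'

/-- The coefficients `q_k` of `Einv`. [cite: Baker1975, Ch. 2 Lemma 7] -/
def q (S' k : ℕ) : ℂ := PowerSeries.coeff k (Einv σ r S')

/-- `∏_{i ≠ r} (X - σ_i)^S`, i.e. Baker's `U(z) (z - σ_r)^{-S}` (p. 25). [cite: Baker1975, Ch. 2 Lemma 7] -/
def PX (S : ℕ) : ℂ[X] := ∏ i ∈ univ.erase r, (X - C (σ i)) ^ S

/-- `∏_{i ≠ r} (Y + (σ_r - σ_i))^S`, i.e. `PX` in the variable `Y = X - σ_r`. [folklore] -/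
def PY (S : ℕ) : ℂ[X] := ∏ i ∈ univ.erase r, (X + C (σ r - σ i)) ^ S

/-- The truncation `∑_{k ≤ t} q_k Y^k` of `Einv`. [folklore] -/
def QY (S' t : ℕ) : ℂ[X] := ∑ k ∈ range (t + 1), C (q σ r S' k) * X ^ k

/-- `QY` in the variable `X`: `∑_{k ≤ t} q_k (X - σ_r)^k`. [folklore] -/
def QX (S' t : ℕ) : ℂ[X] := ∑ k ∈ range (t + 1), C (q σ r S' k) * (X - C (σ r)) ^ k

/-- Baker's augmentative polynomial for the pair `(r, s)`, with `S = s + t + 1`: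
`W = (1/s!) ∑_{k ≤ t} q_k (X - σ_r)^{s+k} ∏_{i ≠ r} (X - σ_i)^S` (Baker 1975, p. 25, the second
expression for `W(z)`). [cite: Baker1975, Ch. 2 Lemma 7] -/
def W (s t : ℕ) : ℂ[X] :=
  ∑ k ∈ range (t + 1), C (((s.factorial : ℕ) : ℂ)⁻¹ * q σ r (s + t) k) *
    ((X - C (σ r)) ^ (s + k) * PX σ r (s + t + 1))

/-- `PY · Einv = 1` in `ℂ⟦Y⟧` (the `σᵢ` being distinct). [folklore] -/
theorem coe_PY_mul_Einv (hσ : Function.Injective σ) (S' : ℕ) :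
    (PY σ r (S' + 1) : PowerSeries ℂ) * Einv σ r S' = 1 := by
  have hcoe : (PY σ r (S' + 1) : PowerSeries ℂ) =
      ∏ i ∈ univ.erase r, (PowerSeries.X + PowerSeries.C (σ r - σ i)) ^ (S' + 1) := by
    change Polynomial.coeToPowerSeries.ringHom (PY σ r (S' + 1)) = _
    rw [PY, map_prod]
    refine prod_congr rfl fun i _ => ?_
    rw [map_pow, Polynomial.coeToPowerSeries.ringHom_apply, Polynomial.coe_add, Polynomial.coe_X,
      Polynomial.coe_C]
  rw [hcoe, Einv, ← prod_mul_distrib]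
  refine prod_eq_one fun i hi => ?_
  apply linPow_mul_invPow
  have : i ≠ r := (mem_erase.mp hi).1
  exact sub_ne_zero.mpr fun h => this (hσ h).symm

/-- The coefficients of `QY` are the `q_k`, `k ≤ t`. [folklore] -/
theorem coeff_QY (S' t k : ℕ) (hk : k ≤ t) : (QY σ r S' t).coeff k = q σ r S' k := by
  simp only [QY, finsetSum_coeff, coeff_C_mul_X_pow]
  rw [Finset.sum_ite_eq, if_pos (mem_range.mpr (by omega))]

/-- `Y^{t+1} ∣ QY · PY - 1`: `QY` inverts `PY` to order `t`. [folklore] -/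
theorem X_pow_dvd (hσ : Function.Injective σ) (S' t : ℕ) :
    (X : ℂ[X]) ^ (t + 1) ∣ QY σ r S' t * PY σ r (S' + 1) - 1 := by
  rw [Polynomial.X_pow_dvd_iff]
  intro d hd
  have hE := coe_PY_mul_Einv σ r hσ S'
  have hc : PowerSeries.coeff d (Einv σ r S' * (PY σ r (S' + 1) : PowerSeries ℂ)) =
      PowerSeries.coeff d (1 : PowerSeries ℂ) := by rw [mul_comm, hE]
  rw [PowerSeries.coeff_mul, PowerSeries.coeff_one] at hc
  rw [coeff_sub, Polynomial.coeff_mul, coeff_one]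
  rw [← hc, sub_eq_zero]
  refine sum_congr rfl fun p hp => ?_
  rw [Finset.HasAntidiagonal.mem_antidiagonal] at hp
  rw [Polynomial.coeff_coe, coeff_QY σ r S' t p.1 (by omega), q]

/-- Change of variable `Y = X - σ_r` in `PY`. [folklore] -/
theorem PY_comp (S : ℕ) : (PY σ r S).comp (X - C (σ r)) = PX σ r S := by
  rw [PY, PX, Polynomial.prod_comp]
  refine prod_congr rfl fun i _ => ?_
  rw [pow_comp, add_comp, X_comp, C_comp]
  congr 1
  rw [map_sub]
  ring

/-- Change of variable `Y = X - σ_r` in `QY`. [folklore] -/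
theorem QY_comp (S' t : ℕ) : (QY σ r S' t).comp (X - C (σ r)) = QX σ r S' t := by
  rw [QY, QX, Polynomial.sum_comp]
  refine sum_congr rfl fun k _ => ?_
  rw [mul_comp, C_comp, X_pow_comp]

/-- `(X - σ_r)^{t+1} ∣ QX · PX - 1`. [folklore] -/
theorem X_sub_C_pow_dvd (hσ : Function.Injective σ) (S' t : ℕ) :
    (X - C (σ r)) ^ (t + 1) ∣ QX σ r S' t * PX σ r (S' + 1) - 1 := by
  obtain ⟨G, hG⟩ := X_pow_dvd σ r hσ S' t
  have h := congrArg (fun p => p.comp (X - C (σ r))) hG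
  simp only [sub_comp, mul_comp, one_comp, QY_comp, PY_comp, X_pow_comp] at h
  exact ⟨G.comp (X - C (σ r)), h⟩

/-- `W = (1/s!) (X - σ_r)^s · QX · PX`. [folklore] -/
theorem W_eq (s t : ℕ) : W σ r s t =
    C (((s.factorial : ℕ) : ℂ)⁻¹) * (X - C (σ r)) ^ s * (QX σ r (s + t) t * PX σ r (s + t + 1)) := by
  rw [W, QX, Finset.sum_mul, Finset.mul_sum]
  refine sum_congr rfl fun k _ => ?_
  rw [map_mul, pow_add]
  ring

/-- `(X - σ_r)^S ∣ W - (X - σ_r)^s / s!` (Baker 1975, p. 25: `W(z) = (z-σ_r)^s/s! + U(z)(…)`).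
[cite: Baker1975, Ch. 2 Lemma 7] -/
theorem dvd_W_sub (hσ : Function.Injective σ) (s t : ℕ) :
    (X - C (σ r)) ^ (s + t + 1) ∣
      W σ r s t - C (((s.factorial : ℕ) : ℂ)⁻¹) * (X - C (σ r)) ^ s := by
  have h := X_sub_C_pow_dvd σ r hσ (s + t) t
  have : W σ r s t - C (((s.factorial : ℕ) : ℂ)⁻¹) * (X - C (σ r)) ^ s =
      C (((s.factorial : ℕ) : ℂ)⁻¹) * ((X - C (σ r)) ^ s *
        (QX σ r (s + t) t * PX σ r (s + t + 1) - 1)) := by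
    rw [W_eq]; ring
  rw [this, add_assoc, pow_add]
  exact dvd_mul_of_dvd_right (mul_dvd_mul_left _ h) _

/-- `(X - σ_i)^S ∣ W` for `i ≠ r` (Baker 1975, p. 26: `W`, like `U`, has a zero of order `S` at `σ_i`).
[cite: Baker1975, Ch. 2 Lemma 7] -/
theorem dvd_W_of_ne (s t : ℕ) {i : Fin R} (hi : i ≠ r) :
    (X - C (σ i)) ^ (s + t + 1) ∣ W σ r s t := by
  have hP : (X - C (σ i)) ^ (s + t + 1) ∣ PX σ r (s + t + 1) :=
    dvd_prod_of_mem (fun j => (X - C (σ j)) ^ (s + t + 1)) (mem_erase.mpr ⟨hi, mem_univ _⟩)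
  refine dvd_sum fun k _ => ?_
  exact dvd_mul_of_dvd_right (dvd_mul_of_dvd_right hP _) _

/-- If `(X - c)^S ∣ p` and `j < S` then `p^{(j)}(c) = 0`. [folklore] -/
theorem eval_iterate_derivative_eq_zero_of_dvd {p : ℂ[X]} {c : ℂ} {S j : ℕ}
    (h : (X - C c) ^ S ∣ p) (hj : j < S) : (derivative^[j] p).eval c = 0 := by
  have h1 := pow_sub_dvd_iterate_derivative_of_pow_dvd j h
  have h2 : (X - C c) ∣ derivative^[j] p := (dvd_pow_self _ (by omega)).trans h1
  exact dvd_iff_isRoot.mp h2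

/-- `(c (X - a)^s)^{(j)}(a) = c · s!` if `j = s` and `0` otherwise. [folklore] -/
theorem eval_iterate_derivative_C_mul_X_sub_pow (c a : ℂ) (s j : ℕ) :
    (derivative^[j] (C c * (X - C a) ^ s)).eval a = if j = s then c * (s.factorial : ℕ) else 0 := by
  rw [iterate_derivative_C_mul, iterate_derivative_X_sub_pow, eval_mul, eval_C, eval_smul,
    eval_pow, eval_sub, eval_X, eval_C, sub_self, nsmul_eq_mul]
  rcases lt_trichotomy j s with h | h | h
  · rw [zero_pow (by omega), if_neg (by omega)]; simp
  · subst h; simp [Nat.descFactorial_self]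
  · rw [Nat.descFactorial_eq_zero_iff_lt.mpr h, if_neg (by omega)]; simp

/-- The Hermite interpolation conditions satisfied by `W`: `W^{(j)}(σ_i) = δ_{(i,j),(r,s)}` for
`j < S` (Baker 1975, Lemma 7, pp. 25–26). [cite: Baker1975, Ch. 2 Lemma 7] -/
theorem eval_iterate_derivative_W (hσ : Function.Injective σ) (s t : ℕ) (i : Fin R) {j : ℕ}
    (hj : j < s + t + 1) :
    (derivative^[j] (W σ r s t)).eval (σ i) = if i = r ∧ j = s then 1 else 0 := by
  by_cases hi : i = r
  · subst hi
    have h1 := eval_iterate_derivative_eq_zero_of_dvd (dvd_W_sub σ i hσ s t) hj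
    rw [iterate_derivative_sub, eval_sub, sub_eq_zero] at h1
    rw [h1, eval_iterate_derivative_C_mul_X_sub_pow]
    by_cases hjs : j = s
    · rw [if_pos hjs, if_pos ⟨rfl, hjs⟩, inv_mul_cancel₀]
      exact_mod_cast (Nat.factorial_pos s).ne'
    · rw [if_neg hjs, if_neg (fun h => hjs h.2)]
  · rw [eval_iterate_derivative_eq_zero_of_dvd (dvd_W_of_ne σ r s t hi) hj, if_neg (fun h => hi h.1)]

/-- Degree bound `deg W ≤ RS - 1` (Baker 1975, p. 26). [cite: Baker1975, Ch. 2 Lemma 7] -/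
theorem natDegree_W_le (s t : ℕ) :
    (W σ r s t).natDegree ≤ s + t + (R - 1) * (s + t + 1) := by
  have hPX : (PX σ r (s + t + 1)).natDegree ≤ (R - 1) * (s + t + 1) := by
    refine (natDegree_prod_le _ _).trans ?_
    calc ∑ i ∈ univ.erase r, ((X - C (σ i)) ^ (s + t + 1)).natDegree
        ≤ ∑ _i ∈ univ.erase r, (s + t + 1) := by
          refine sum_le_sum fun i _ => ?_
          refine natDegree_pow_le.trans ?_
          rw [natDegree_X_sub_C, mul_one]
      _ = (R - 1) * (s + t + 1) := by simp [card_erase_of_mem, mul_comm]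
  refine natDegree_sum_le_of_forall_le _ _ fun k hk => ?_
  rw [mem_range] at hk
  refine (natDegree_C_mul_le _ _).trans ?_
  refine natDegree_mul_le.trans ?_
  have h1 : ((X - C (σ r)) ^ (s + k)).natDegree ≤ s + k := by
    refine natDegree_pow_le.trans ?_
    rw [natDegree_X_sub_C, mul_one]
  omega

/-- Coefficient bound `|w_j| ≤ (8σ/ρ)^{RS}` (Baker 1975, p. 26). [cite: Baker1975, Ch. 2 Lemma 7] -/
theorem norm_coeff_W_le (hσ : Function.Injective σ) (s t : ℕ) {σM ρ : ℝ} (hσM : 1 ≤ σM)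
    (hσb : ∀ i, ‖σ i‖ ≤ σM) (hρ : 0 < ρ) (hρ1 : ρ ≤ 1)
    (hsep : ∀ i j, i ≠ j → ρ ≤ ‖σ i - σ j‖) (j : ℕ) :
    ‖(W σ r s t).coeff j‖ ≤ (8 * σM / ρ) ^ (R * (s + t + 1)) := by
  obtain ⟨R', rfl⟩ : ∃ R', R = R' + 1 := ⟨R - 1, by have := r.pos; omega⟩
  set S := s + t + 1 with hS
  have hα : (1 : ℝ) ≤ 2 / ρ := by rw [le_div_iff₀ hρ]; linarith
  have hα0 : (0 : ℝ) ≤ 2 / ρ := by positivity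
  -- bound on the `q_k`
  have hq : TGB t (Einv σ r (s + t)) (((t + 1) * (2 / ρ) ^ S) ^ R') (2 / ρ) := by
    have := TGB.prod (univ.erase r) (fun i => invPow (σ r - σ i) (s + t)) (t := t)
      (A := (2 / ρ) ^ S) (α := 2 / ρ) (by positivity) hα0 ?_
    · simpa [Einv, card_erase_of_mem] using this
    · intro i hi k _
      have hir : i ≠ r := (mem_erase.mp hi).1
      exact norm_coeff_invPow_le _ _ _ hρ (hsep _ _ (Ne.symm hir))
  -- bound on the monic products
  have hT : ∀ k ≤ t, ∀ j, ‖((X - C (σ r)) ^ (s + k) * PX σ r S).coeff j‖ ≤ (1 + σM) ^ ((R' + 1) * S) := by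
    intro k hk j
    have h1 : ∀ j, ‖((1 : ℂ[X]) * (X - C (σ r)) ^ (s + k)).coeff j‖ ≤ 1 * (1 + σM) ^ (s + k) :=
      fun j => norm_coeff_mul_X_sub_C_pow_le (p := 1) (B := 1)
        (fun j => by rw [coeff_one]; split_ifs <;> simp) (by linarith) (hσb r) _ j
    have h2 := norm_coeff_mul_prod_pow_le (univ.erase r) h1 (by linarith) σ (fun i _ => hσb i)
      (fun _ => S) j
    rw [one_mul, one_mul] at h2
    refine (le_of_eq_of_le (by rw [PX]) h2).trans ?_
    rw [← pow_add]
    refine pow_le_pow_right₀ (by linarith) ?_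
    simp only [sum_const, card_erase_of_mem (mem_univ r), card_univ, Fintype.card_fin,
      smul_eq_mul, Nat.add_sub_cancel]
    have : (R' + 1) * S = R' * S + S := by ring
    omega
  -- sum up
  rw [W, finsetSum_coeff]
  calc ‖∑ k ∈ range (t + 1), (C (((s.factorial : ℕ) : ℂ)⁻¹ * q σ r (s + t) k) *
          ((X - C (σ r)) ^ (s + k) * PX σ r S)).coeff j‖
      ≤ ∑ k ∈ range (t + 1), ‖(C (((s.factorial : ℕ) : ℂ)⁻¹ * q σ r (s + t) k) *
          ((X - C (σ r)) ^ (s + k) * PX σ r S)).coeff j‖ := norm_sum_le _ _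
    _ ≤ ∑ _k ∈ range (t + 1), ((t + 1) * (2 / ρ) ^ S) ^ R' * (2 / ρ) ^ t *
          (1 + σM) ^ ((R' + 1) * S) := by
        refine sum_le_sum fun k hk => ?_
        rw [mem_range] at hk
        rw [coeff_C_mul, norm_mul, norm_mul, norm_inv, Complex.norm_natCast]
        have hqk : ‖q σ r (s + t) k‖ ≤ ((t + 1) * (2 / ρ) ^ S) ^ R' * (2 / ρ) ^ t := by
          refine (hq k (by omega)).trans ?_
          exact mul_le_mul_of_nonneg_left (pow_le_pow_right₀ hα (by omega)) (by positivity)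
        have hfac : ((s.factorial : ℕ) : ℝ)⁻¹ ≤ 1 := by
          apply inv_le_one_of_one_le₀
          exact_mod_cast Nat.succ_le_of_lt (Nat.factorial_pos s)
        calc ((s.factorial : ℕ) : ℝ)⁻¹ * ‖q σ r (s + t) k‖ *
              ‖((X - C (σ r)) ^ (s + k) * PX σ r S).coeff j‖
            ≤ 1 * (((t + 1) * (2 / ρ) ^ S) ^ R' * (2 / ρ) ^ t) * (1 + σM) ^ ((R' + 1) * S) := by
              gcongr
              exact hT k (by omega) j
          _ = _ := by ring
    _ = (t + 1) * (((t + 1) * (2 / ρ) ^ S) ^ R' * (2 / ρ) ^ t * (1 + σM) ^ ((R' + 1) * S)) := by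
        simp [sum_const, card_range]
    _ = (t + 1) ^ (R' + 1) * ((2 / ρ) ^ (S * R' + t)) * (1 + σM) ^ ((R' + 1) * S) := by
        rw [mul_pow, ← pow_mul, pow_add]; ring
    _ ≤ (2 ^ S) ^ (R' + 1) * (2 / ρ) ^ ((R' + 1) * S) * (2 * σM) ^ ((R' + 1) * S) := by
        have ht : (t : ℝ) + 1 ≤ 2 ^ S := by
          have h2 : S < 2 ^ S := Nat.lt_two_pow_self
          exact_mod_cast (show t + 1 ≤ 2 ^ S by omega)
        have e1 : ((t : ℝ) + 1) ^ (R' + 1) ≤ (2 ^ S) ^ (R' + 1) :=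
          pow_le_pow_left₀ (by positivity) ht _
        have e2 : (2 / ρ) ^ (S * R' + t) ≤ (2 / ρ) ^ ((R' + 1) * S) := by
          refine pow_le_pow_right₀ hα ?_
          have : (R' + 1) * S = S * R' + S := by ring
          omega
        have e3 : (1 + σM) ^ ((R' + 1) * S) ≤ (2 * σM) ^ ((R' + 1) * S) :=
          pow_le_pow_left₀ (by positivity) (by linarith) _
        exact mul_le_mul (mul_le_mul e1 e2 (by positivity) (by positivity)) e3 (by positivity)
          (by positivity)
    _ = (8 * σM / ρ) ^ ((R' + 1) * S) := by
        rw [← pow_mul, mul_comm S (R' + 1), ← mul_pow, ← mul_pow]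
        congr 1
        field_simp
        ring

end Construction

/-- Lemma 7 with the statement spelled out (see `lemma7_holds`). [cite: Baker1975, Ch. 2 Lemma 7] -/
theorem lemma7_holds_aux : ∀ (R S : ℕ) (σ : Fin R → ℂ), Function.Injective σ →
    ∀ (σM ρ : ℝ), 1 ≤ σM → (∀ i, ‖σ i‖ ≤ σM) → 0 < ρ → ρ ≤ 1 →
      (∀ i j, i ≠ j → ρ ≤ ‖σ i - σ j‖) →
    ∀ (r : Fin R) (s : Fin S),
      ∃ W : ℂ[X], W.degree < (R * S : ℕ) ∧
        (∀ j, ‖W.coeff j‖ ≤ (8 * σM / ρ) ^ (R * S)) ∧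
        ∀ (i : Fin R) (j : Fin S),
          (derivative^[j] W).eval (σ i) = if i = r ∧ j = s then 1 else 0 := by
  intro R S σ hσ σM ρ hσM hσb hρ hρ1 hsep r s
  obtain ⟨t, hSt⟩ : ∃ t, S = (s : ℕ) + t + 1 := ⟨S - 1 - s, by have := s.isLt; omega⟩
  have hRS : R * S = R * ((s : ℕ) + t + 1) := by rw [← hSt]
  refine ⟨W σ r s t, ?_, ?_, ?_⟩
  · rw [hRS]
    refine (degree_le_natDegree.trans_lt ?_)
    have h := natDegree_W_le σ r (s : ℕ) t
    have hR : R * ((s : ℕ) + t + 1) = (R - 1) * ((s : ℕ) + t + 1) + ((s : ℕ) + t + 1) := by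
      obtain ⟨R', rfl⟩ : ∃ R', R = R' + 1 := ⟨R - 1, by have := r.pos; omega⟩
      simp; ring
    exact_mod_cast (show (W σ r (↑s) t).natDegree < R * (↑s + t + 1) by omega)
  · intro j; rw [hRS]; exact norm_coeff_W_le σ r hσ s t hσM hσb hρ hρ1 hsep j
  · intro i j
    have hj : (j : ℕ) < (s : ℕ) + t + 1 := by have := j.isLt; omega
    rw [eval_iterate_derivative_W σ r hσ s t i hj]
    by_cases h : i = r ∧ j = s
    · rw [if_pos h, if_pos ⟨h.1, by rw [h.2]⟩]
    · rw [if_neg h, if_neg (fun h' => h ⟨h'.1, Fin.ext h'.2⟩)]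



end L7

/-- **Baker 1975, Ch. 2, Lemma 7, proved**: the named fact `Lemma7` holds. The witness is
`L7.W σ r s (S - 1 - s)`. [cite: Baker1975, Ch. 2 Lemma 7] -/
theorem lemma7_holds : Lemma7 := L7.lemma7_holds_aux

/-- **Discharge of the named fact `Lemma7`** (Baker 1975, Ch. 2, Lemma 7, p. 25) under the
conventional name `<Fact>_holds`: the same proof as `lemma7_holds` (witness `L7.W σ r s (S - 1 - s)`,
Hermite conditions `L7.eval_iterate_derivative_W`, degree `L7.natDegree_W_le`, coefficient bound
`L7.norm_coeff_W_le`). [cite: Baker1975, Ch. 2 Lemma 7] -/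
theorem Lemma7_holds : Lemma7 := L7.lemma7_holds_aux

end Literature.NumberTheory.Transcendental.Baker1975
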